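import Summits.QuantumFields.BalabanUV.T4Continuum.Support.DirichletDirectionalBesovCutoff

/-!
# `BalabanUV.T4Continuum.Support.DirichletRelativeBesov` — NE2 (node U1a) formalisation swarm, sub-row `T4-U1a.S-NE2-D1-DIRICHLET°`: gen 3's
# one-sided Besov END (`DirichletDirectionalBesovCutoff.nsq_sdiff_sdiff_le`) under hypotheses RELATIVE TO THE SUPPORT of the field — the
# cutoff need only be admissible where the field is non-zero and smooth at the region's sites adjacent to the support (brick H-D of the
# typed plan «Δ1-HOLEFILL» for the located residue of «Δ1-LOCAL», `t4/T4-EST-NE2-D1-LOCAL.md` §5) (unit b2b-balaban-t4-ne2-formalise-leaf-08, gen 5, file 9)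

HONEST FRAMING.  Rung (B)+1 bookkeeping at MODEL level, finite torus; [folklore] finite lattice calculus; NE2 (U1a) is NOT proved by this file;
spine PROVED 0/9 unchanged; NOT infinite volume, NOT the mass gap, NOT Clay.  HONEST DEPENDENCY (verbatim): «continuum YM on T⁴ ⇐ BetaPertH ∧
nine spine estimates (0/9 proved); BetaPertH ⇐ (D1) ∧ (D4) ∧ CAP+tail; G-an2-4 gates asym, D1 and NE2/3/4.»

WHY.  At a conflict vertex (file 7 `DirichletSplittableResidue`) no GLOBALLY smooth admissible cutoff exists at any scale; the planned way
around (memo §5) cuts a scale-ρ neighbourhood of the conflict locus out of the vertex field and splits the remainder with a cutoff `ψ` that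
is admissible and smooth only AWAY from that locus — possibly defined block by block (Ω-intrinsic), with no control across bonds that the
field does not see.  Gen 3's structure `AdmissibleCutoff` asks for `ψ = 0 ∕ 1` on ALL exposed sites and Lipschitz ∕ second-difference
bounds at ALL sites.  THIS FILE re-proves the END under weaker [shape] hypotheses: the SMOOTHNESS structure **`RelSmooth Ω z ψ ℓ₁ ℓ₂`** (`0 ≤ ψ ≤ 1`
everywhere; `|ψ(x ± e_ν) − ψ x| ≤ ℓ₁` and `|2ψ x − ψ(x+e_ν) − ψ(x−e_ν)| ≤ ℓ₂` only at sites `x ∈ Ω` with `z x ≠ 0 ∨ z(x+e_ν) ≠ 0 ∨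
z(x−e_ν) ≠ 0` — inherited by `1 − ψ`), and the two RELATIVE admissibility hypotheses `ψ x = 0` (resp. `= 1`) at exposed `−μ` (resp. `+μ`)
sites WITH `z x ≠ 0`.  Results (0 sorry): `norm_sdiff_cut_sq_le`, `energy_cut_le_rel`, `sqrt_nsq_restrict_LapS_cut_le_rel`,
`admissible_pos_rel ∕ _neg_rel`, and THE END **`nsq_sdiff_sdiff_le_rel`** ∕ **`nsq_sdiffH_sdiff_le_rel`** with LITERALLY gen 3's right-hand side
`8‖c‖·√(2E(z) + 2d‖c‖²ℓ₁²‖z‖²)·(‖1_ΩΔz‖ + Σ_ν(2‖c‖ℓ₁‖∂_νz‖ + ‖c‖²ℓ₂‖z‖))`; `RelSmooth.of_admissibleCutoff`: gen 3's structure is an instance.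

ABSOLUTE RULE (cell, verbatim): «No internally-minted statement may enter as a cited fact. Every hypothesis is either kernel-proved in
this package or a verbatim quotation of a PUBLISHED theorem with page reference. The manuscript(s) under audit are NOT citable for
their own disputed steps — they are the thing under adjudication; programme-internal (2001/route/tribunal) claims are never citable.»
[folklore]; one parametrised hypothesis STRUCTURE on data; no `def … : Prop` fact.  NOT CLAIMED: any cutoff construction (H-E), anything at
the residue; NE2; NE3.
-/

noncomputable section

open scoped BigOperators ComplexConjugate Matrix
open Finset

namespace Summit.QuantumFields.BalabanUV.T4Continuum.DirichletRelativeBesov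

open Literature.MathematicalPhysics.QuantumFieldTheory.Balaban1983to89.B5Prop11Plancherel (Tor unitVec)
open Literature.MathematicalPhysics.QuantumFieldTheory.Balaban1983to89.B5Action121 (sdiff LapS sdiff_mulVec LapS_mulVec)
open Literature.MathematicalPhysics.QuantumFieldTheory.Balaban1983to89.B5Prop11Lower (nsq nsq_nonneg)
open Summit.QuantumFields.BalabanUV.T4Continuum.ScalarBlockPoincare (nsq_add_le nsq_smul transS nsq_transS)
open Summit.QuantumFields.BalabanUV.T4Continuum.DirichletDirectionalBesov
open Summit.QuantumFields.BalabanUV.T4Continuum.DirichletDirectionalBesovCutoff (cut energy AdmissibleCutoff transl_sub_transl_eq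
  cut_add_cut_compl nsq_sdiffH_sdiff_eq LapS_cut norm_ofReal_le_one)

variable {d : ℕ} (N : Fin d → ℕ) [hN : ∀ μ, NeZero (N μ)]

/-! ## §1 The relative smoothness structure -/

/-- [shape] **SMOOTHNESS OF THE CUTOFF RELATIVE TO THE FIELD `z`** on the region `Ω`: values in `[0,1]`; first and pure second differences
bounded only at sites of `Ω` that are `ν`-adjacent to the support of `z`. [folklore] -/
structure RelSmooth (Ω : Tor N → Prop) (z : Tor N → ℂ) (ψ : Tor N → ℝ) (ℓ₁ ℓ₂ : ℝ) : Prop where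
  nonneg : ∀ x, 0 ≤ ψ x
  le_one : ∀ x, ψ x ≤ 1
  ell1_nonneg : 0 ≤ ℓ₁
  ell2_nonneg : 0 ≤ ℓ₂
  lip : ∀ x (ν : Fin d), Ω x → (z x ≠ 0 ∨ z (x + unitVec N ν) ≠ 0 ∨ z (x - unitVec N ν) ≠ 0) →
    |ψ (x + unitVec N ν) - ψ x| ≤ ℓ₁ ∧ |ψ x - ψ (x - unitVec N ν)| ≤ ℓ₁
  lip₂ : ∀ x (ν : Fin d), Ω x → (z x ≠ 0 ∨ z (x + unitVec N ν) ≠ 0 ∨ z (x - unitVec N ν) ≠ 0) →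
    |2 * ψ x - ψ (x + unitVec N ν) - ψ (x - unitVec N ν)| ≤ ℓ₂

namespace RelSmooth

variable {N} {Ω : Tor N → Prop} {z : Tor N → ℂ} {μ : Fin d} {ψ : Tor N → ℝ} {ℓ₁ ℓ₂ : ℝ}

omit hN in
/-- gen 3's global structure gives relative smoothness (for any field). [folklore] -/
theorem of_admissibleCutoff (h : AdmissibleCutoff N Ω μ ψ ℓ₁ ℓ₂) (z : Tor N → ℂ) : RelSmooth N Ω z ψ ℓ₁ ℓ₂ where
  nonneg := h.nonneg
  le_one := h.le_one
  ell1_nonneg := h.ell1_nonneg (fun _ => 0)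
  ell2_nonneg := h.ell2_nonneg (fun _ => 0)
  lip x ν _ _ := ⟨h.lip x ν, by
    have := h.lip (x - unitVec N ν) ν
    rwa [sub_add_cancel] at this⟩
  lip₂ x ν _ _ := h.lip₂ x ν

omit hN in
/-- relative smoothness passes to the complementary cutoff `1 − ψ`. [folklore] -/
theorem compl (h : RelSmooth N Ω z ψ ℓ₁ ℓ₂) : RelSmooth N Ω z (fun y => 1 - ψ y) ℓ₁ ℓ₂ where
  nonneg x := by linarith [h.le_one x]
  le_one x := by linarith [h.nonneg x]
  ell1_nonneg := h.ell1_nonneg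
  ell2_nonneg := h.ell2_nonneg
  lip x ν hx hz := by
    obtain ⟨h1, h2⟩ := h.lip x ν hx hz
    constructor
    · rw [show (1 - ψ (x + unitVec N ν)) - (1 - ψ x) = -(ψ (x + unitVec N ν) - ψ x) by ring, abs_neg]; exact h1
    · rw [show (1 - ψ x) - (1 - ψ (x - unitVec N ν)) = -(ψ x - ψ (x - unitVec N ν)) by ring, abs_neg]; exact h2
  lip₂ x ν hx hz := by
    rw [show 2 * (1 - ψ x) - (1 - ψ (x + unitVec N ν)) - (1 - ψ (x - unitVec N ν))
        = -(2 * ψ x - ψ (x + unitVec N ν) - ψ (x - unitVec N ν)) by ring, abs_neg]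
    exact h.lip₂ x ν hx hz

end RelSmooth

/-! ## §2 Gradient and energy of a cut field under relative smoothness -/

/-- **pointwise gradient of a cut field**: `‖∂_ν(ψz)(x)‖² ≤ 2‖∂_νz(x)‖² + 2‖c‖²ℓ₁²‖z x‖²` whenever the Lipschitz bound holds at `x`
IF both `z x ≠ 0` and `z(x+e_ν) ≠ 0` (on a bond with a zero end no difference of `ψ` is needed). [folklore] -/
theorem norm_sdiff_cut_sq_le (c : ℂ) (ν : Fin d) {ψ : Tor N → ℝ} {ℓ₁ : ℝ} (h0 : ∀ x, 0 ≤ ψ x) (h1 : ∀ x, ψ x ≤ 1)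
    (z : Tor N → ℂ) (x : Tor N) (hlip : z x ≠ 0 → z (x + unitVec N ν) ≠ 0 → |ψ (x + unitVec N ν) - ψ x| ≤ ℓ₁) :
    ‖(sdiff N c ν *ᵥ cut N ψ z) x‖ ^ 2 ≤ 2 * ‖(sdiff N c ν *ᵥ z) x‖ ^ 2 + 2 * ‖c‖ ^ 2 * ℓ₁ ^ 2 * ‖z x‖ ^ 2 := by
  have hψ := norm_ofReal_le_one N h0 h1
  simp only [sdiff_mulVec, cut]
  by_cases hzx : z x = 0
  · -- `∂(ψz)(x) = c·ψ(x+e)·z(x+e) = ψ(x+e)·∂z(x)`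
    rw [hzx, mul_zero, sub_zero, sub_zero, norm_zero]
    have : ‖c * ((ψ (x + unitVec N ν) : ℂ) * z (x + unitVec N ν))‖ ≤ ‖c * z (x + unitVec N ν)‖ := by
      rw [norm_mul, norm_mul, norm_mul]
      calc ‖c‖ * (‖(ψ (x + unitVec N ν) : ℂ)‖ * ‖z (x + unitVec N ν)‖) ≤ ‖c‖ * (1 * ‖z (x + unitVec N ν)‖) := by gcongr; exact hψ _
        _ = ‖c‖ * ‖z (x + unitVec N ν)‖ := by rw [one_mul]
    nlinarith [this, norm_nonneg (c * ((ψ (x + unitVec N ν) : ℂ) * z (x + unitVec N ν))), sq_nonneg (‖c‖ * ℓ₁)]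
  by_cases hzy : z (x + unitVec N ν) = 0
  · -- `∂(ψz)(x) = −c·ψ(x)·z(x) = ψ(x)·∂z(x)`
    simp only [hzy, mul_zero, zero_sub, mul_neg, norm_neg, norm_mul]
    have hψx := hψ x
    have hcz : 0 ≤ ‖c‖ * ‖z x‖ := mul_nonneg (norm_nonneg c) (norm_nonneg (z x))
    have h3 : ‖c‖ * (‖(ψ x : ℂ)‖ * ‖z x‖) ≤ ‖c‖ * ‖z x‖ := by
      rw [← mul_assoc, mul_comm ‖c‖ ‖(ψ x : ℂ)‖, mul_assoc]
      exact (mul_le_mul_of_nonneg_right hψx hcz).trans (by rw [one_mul])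
    have h4 : 0 ≤ ‖c‖ * (‖(ψ x : ℂ)‖ * ‖z x‖) := by positivity
    nlinarith [h3, h4, sq_nonneg (‖c‖ * ℓ₁ * ‖z x‖)]
  · -- both ends carry `z`: the product rule and the Lipschitz bound
    have hl := hlip hzx hzy
    have heq : c * ((ψ (x + unitVec N ν) : ℂ) * z (x + unitVec N ν) - (ψ x : ℂ) * z x)
        = (ψ (x + unitVec N ν) : ℂ) * (c * (z (x + unitVec N ν) - z x)) + c * (((ψ (x + unitVec N ν) - ψ x : ℝ) : ℂ) * z x) := by
      push_cast; ring
    rw [heq]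
    have hA : ‖(ψ (x + unitVec N ν) : ℂ) * (c * (z (x + unitVec N ν) - z x))‖ ≤ ‖c * (z (x + unitVec N ν) - z x)‖ := by
      rw [norm_mul]; exact (mul_le_mul_of_nonneg_right (hψ _) (norm_nonneg _)).trans (by rw [one_mul])
    have hB : ‖c * (((ψ (x + unitVec N ν) - ψ x : ℝ) : ℂ) * z x)‖ ≤ ‖c‖ * ℓ₁ * ‖z x‖ := by
      rw [norm_mul, norm_mul, Complex.norm_real, Real.norm_eq_abs, mul_assoc]
      exact mul_le_mul_of_nonneg_left (mul_le_mul_of_nonneg_right hl (norm_nonneg _)) (norm_nonneg _)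
    have hsum := norm_add_le ((ψ (x + unitVec N ν) : ℂ) * (c * (z (x + unitVec N ν) - z x))) (c * (((ψ (x + unitVec N ν) - ψ x : ℝ) : ℂ) * z x))
    have h0A := norm_nonneg ((ψ (x + unitVec N ν) : ℂ) * (c * (z (x + unitVec N ν) - z x)) + c * (((ψ (x + unitVec N ν) - ψ x : ℝ) : ℂ) * z x))
    nlinarith [hA, hB, hsum, h0A, norm_nonneg (c * (z (x + unitVec N ν) - z x)),
      sq_nonneg (‖c * (z (x + unitVec N ν) - z x)‖ - ‖c‖ * ℓ₁ * ‖z x‖)]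

/-- **energy of a cut field** under relative smoothness: `E(ψz) ≤ 2E(z) + 2d‖c‖²ℓ₁²‖z‖²` (for `z` supported in `Ω`). [folklore] -/
theorem energy_cut_le_rel {Ω : Tor N → Prop} (c : ℂ) {ψ : Tor N → ℝ} {ℓ₁ ℓ₂ : ℝ} {z : Tor N → ℂ}
    (h : RelSmooth N Ω z ψ ℓ₁ ℓ₂) (hz : ∀ x, ¬ Ω x → z x = 0) :
    energy N c (cut N ψ z) ≤ 2 * energy N c z + 2 * d * ‖c‖ ^ 2 * ℓ₁ ^ 2 * nsq z := by
  unfold energy nsq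
  have hpt : ∀ ν x, ‖(sdiff N c ν *ᵥ cut N ψ z) x‖ ^ 2 ≤ 2 * ‖(sdiff N c ν *ᵥ z) x‖ ^ 2 + 2 * ‖c‖ ^ 2 * ℓ₁ ^ 2 * ‖z x‖ ^ 2 :=
    fun ν x => norm_sdiff_cut_sq_le N c ν h.nonneg h.le_one z x fun hzx hzy =>
      (h.lip x ν (by by_contra hx; exact hzx (hz x hx)) (Or.inl hzx)).1
  calc ∑ ν, ∑ x, ‖(sdiff N c ν *ᵥ cut N ψ z) x‖ ^ 2 ≤ ∑ ν : Fin d, ∑ x, (2 * ‖(sdiff N c ν *ᵥ z) x‖ ^ 2 + 2 * ‖c‖ ^ 2 * ℓ₁ ^ 2 * ‖z x‖ ^ 2) :=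
        Finset.sum_le_sum fun ν _ => Finset.sum_le_sum fun x _ => hpt ν x
    _ = 2 * ∑ ν, ∑ x, ‖(sdiff N c ν *ᵥ z) x‖ ^ 2 + 2 * d * ‖c‖ ^ 2 * ℓ₁ ^ 2 * ∑ x, ‖z x‖ ^ 2 := by
        simp only [Finset.sum_add_distrib, ← Finset.mul_sum, Finset.sum_const, Finset.card_univ, Fintype.card_fin, nsmul_eq_mul]; ring

/-! ## §3 The compressed Laplacian of a cut field under relative smoothness -/

/-- **the commutator bound, restricted to `Ω` BEFORE estimating**: for `z` supported in `Ω` and `ψ` relatively admissible,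
`‖1_Ω·Δ(ψz)‖ ≤ ‖1_Ω·Δz‖ + Σ_ν (2‖c‖ℓ₁‖∂_νz‖ + ‖c‖²ℓ₂‖z‖)`. [folklore] -/
theorem sqrt_nsq_restrict_LapS_cut_le_rel {Ω : Tor N → Prop} [DecidablePred Ω] (c : ℂ) (hc : c ≠ 0) {ψ : Tor N → ℝ}
    {ℓ₁ ℓ₂ : ℝ} {z : Tor N → ℂ} (h : RelSmooth N Ω z ψ ℓ₁ ℓ₂) :
    Real.sqrt (nsq (restrictTo Ω (LapS N c *ᵥ cut N ψ z)))
      ≤ Real.sqrt (nsqOn Ω (LapS N c *ᵥ z))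
        + ∑ ν, (2 * ‖c‖ * ℓ₁ * Real.sqrt (nsq (sdiff N c ν *ᵥ z)) + ‖c‖ ^ 2 * ℓ₂ * Real.sqrt (nsq z)) := by
  have hc0 : 0 < ‖c‖ := norm_pos_iff.mpr hc
  have hℓ₁ := h.ell1_nonneg
  have hℓ₂ := h.ell2_nonneg
  -- the RESTRICTED commutator: coefficients vanish off `Ω` and where no neighbour carries `z`
  set α : Fin d → Tor N → ℂ := fun ν x =>
    if Ω x ∧ (z x ≠ 0 ∨ z (x + unitVec N ν) ≠ 0 ∨ z (x - unitVec N ν) ≠ 0) then (((ψ x - ψ (x + unitVec N ν) : ℝ)) : ℂ) else 0 with hα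
  set β : Fin d → Tor N → ℂ := fun ν x =>
    if Ω x ∧ (z x ≠ 0 ∨ z (x + unitVec N ν) ≠ 0 ∨ z (x - unitVec N ν) ≠ 0) then (((2 * ψ x - ψ (x + unitVec N ν) - ψ (x - unitVec N ν) : ℝ)) : ℂ)
    else 0 with hβ
  set S : Tor N → ℂ := ∑ ν, (conj c * c) • ((fun x => α ν x * (z (x + unitVec N ν) - z (x - unitVec N ν)))
            + (fun x => β ν x * z (x - unitVec N ν))) with hS
  have hdec : restrictTo Ω (LapS N c *ᵥ cut N ψ z) = cut N ψ (restrictTo Ω (LapS N c *ᵥ z)) + restrictTo Ω S := by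
    funext x
    rw [LapS_cut]
    simp only [restrictTo, cut, Pi.add_apply, hS, Finset.sum_apply, Pi.smul_apply, smul_eq_mul, hα, hβ]
    by_cases hx : Ω x
    · simp only [if_pos hx]
      congr 1
      refine Finset.sum_congr rfl fun ν _ => ?_
      by_cases hnb : z x ≠ 0 ∨ z (x + unitVec N ν) ≠ 0 ∨ z (x - unitVec N ν) ≠ 0
      · rw [if_pos ⟨hx, hnb⟩, if_pos ⟨hx, hnb⟩]
      · push Not at hnb
        obtain ⟨h1, h2, h3⟩ := hnb
        have hneg : ¬ (Ω x ∧ (z x ≠ 0 ∨ z (x + unitVec N ν) ≠ 0 ∨ z (x - unitVec N ν) ≠ 0)) := fun h =>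
          h.2.elim (fun h' => h' h1) (fun h' => h'.elim (fun h'' => h'' h2) (fun h'' => h'' h3))
        rw [if_neg hneg, if_neg hneg, h2, h3]
        simp
    · simp [if_neg hx]
  rw [hdec]
  refine (sqrt_nsq_add_le _ _).trans (add_le_add ?_ ?_)
  · calc Real.sqrt (nsq (cut N ψ (restrictTo Ω (LapS N c *ᵥ z)))) ≤ 1 * Real.sqrt (nsq (restrictTo Ω (LapS N c *ᵥ z))) :=
          sqrt_nsq_mul_le zero_le_one (fun x => norm_ofReal_le_one N h.nonneg h.le_one x) _
      _ = Real.sqrt (nsqOn Ω (LapS N c *ᵥ z)) := by rw [one_mul, nsq_restrictTo]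
  · have hαb : ∀ ν x, ‖α ν x‖ ≤ ℓ₁ := fun ν x => by
      simp only [hα]
      split_ifs with hcond
      · rw [Complex.norm_real, Real.norm_eq_abs, abs_sub_comm]; exact (h.lip x ν hcond.1 hcond.2).1
      · rw [norm_zero]; exact hℓ₁
    have hβb : ∀ ν x, ‖β ν x‖ ≤ ℓ₂ := fun ν x => by
      simp only [hβ]
      split_ifs with hcond
      · rw [Complex.norm_real, Real.norm_eq_abs]; exact h.lip₂ x ν hcond.1 hcond.2
      · rw [norm_zero]; exact hℓ₂
    calc Real.sqrt (nsq (restrictTo Ω S)) ≤ Real.sqrt (nsq S) := sqrt_nsq_mono (norm_restrictTo_le Ω S)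
      _ ≤ ∑ ν, Real.sqrt (nsq ((conj c * c) • ((fun x => α ν x * (z (x + unitVec N ν) - z (x - unitVec N ν)))
            + (fun x => β ν x * z (x - unitVec N ν))))) := sqrt_nsq_sum_le _ _
      _ ≤ ∑ ν, (2 * ‖c‖ * ℓ₁ * Real.sqrt (nsq (sdiff N c ν *ᵥ z)) + ‖c‖ ^ 2 * ℓ₂ * Real.sqrt (nsq z)) := by
          refine Finset.sum_le_sum fun ν _ => ?_
          rw [sqrt_nsq_smul, norm_mul, Complex.norm_conj, ← sq]
          have hA : Real.sqrt (nsq (fun x => α ν x * (z (x + unitVec N ν) - z (x - unitVec N ν))))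
              ≤ ℓ₁ * (‖c‖⁻¹ * (2 * Real.sqrt (nsq (sdiff N c ν *ᵥ z)))) := by
            refine (sqrt_nsq_mul_le hℓ₁ (hαb ν) _).trans (mul_le_mul_of_nonneg_left ?_ hℓ₁)
            rw [transl_sub_transl_eq N c hc ν z, sqrt_nsq_smul, norm_inv]
            refine mul_le_mul_of_nonneg_left ((sqrt_nsq_add_le _ _).trans ?_) (inv_nonneg.mpr hc0.le)
            rw [nsq_transS, two_mul]
          have hB : Real.sqrt (nsq (fun x => β ν x * z (x - unitVec N ν))) ≤ ℓ₂ * Real.sqrt (nsq z) := by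
            refine (sqrt_nsq_mul_le hℓ₂ (hβb ν) _).trans (le_of_eq ?_)
            have : (fun x => z (x - unitVec N ν)) = transS N (-unitVec N ν) z := by funext x; simp [transS, sub_eq_add_neg]
            rw [this, nsq_transS]
          calc ‖c‖ ^ 2 * Real.sqrt (nsq ((fun x => α ν x * (z (x + unitVec N ν) - z (x - unitVec N ν))) + fun x => β ν x * z (x - unitVec N ν)))
              ≤ ‖c‖ ^ 2 * (ℓ₁ * (‖c‖⁻¹ * (2 * Real.sqrt (nsq (sdiff N c ν *ᵥ z)))) + ℓ₂ * Real.sqrt (nsq z)) :=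
                mul_le_mul_of_nonneg_left ((sqrt_nsq_add_le _ _).trans (add_le_add hA hB)) (sq_nonneg _)
            _ = 2 * ‖c‖ * ℓ₁ * Real.sqrt (nsq (sdiff N c ν *ᵥ z)) + ‖c‖ ^ 2 * ℓ₂ * Real.sqrt (nsq z) := by field_simp

/-! ## §4 Relative admissibility and THE END -/

omit hN in
/-- `ψz` translates by `+e_μ` inside `Ω` if `ψ = 0` at the exposed `−μ` sites CARRYING `z`. [folklore] -/
theorem admissible_pos_rel {Ω : Tor N → Prop} {μ : Fin d} {ψ : Tor N → ℝ} {z : Tor N → ℂ}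
    (hzero : ∀ x, Ω x → ¬ Ω (x - unitVec N μ) → z x ≠ 0 → ψ x = 0) (hz : ∀ x, ¬ Ω x → z x = 0) :
    ∀ x, ¬ Ω x → (transS N (unitVec N μ) (cut N ψ z) - cut N ψ z) x = 0 := by
  intro x hx
  simp only [Pi.sub_apply, transS, cut, hz x hx, mul_zero, sub_zero]
  by_cases hy : Ω (x + unitVec N μ)
  · by_cases hzy : z (x + unitVec N μ) = 0
    · rw [hzy, mul_zero]
    · rw [hzero _ hy (by rwa [add_sub_cancel_right]) hzy, Complex.ofReal_zero, zero_mul]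
  · rw [hz _ hy, mul_zero]

omit hN in
/-- `(1−ψ)z` translates by `−e_μ` inside `Ω` if `ψ = 1` at the exposed `+μ` sites CARRYING `z`. [folklore] -/
theorem admissible_neg_rel {Ω : Tor N → Prop} {μ : Fin d} {ψ : Tor N → ℝ} {z : Tor N → ℂ}
    (hone : ∀ x, Ω x → ¬ Ω (x + unitVec N μ) → z x ≠ 0 → ψ x = 1) (hz : ∀ x, ¬ Ω x → z x = 0) :
    ∀ x, ¬ Ω x → (transS N (-unitVec N μ) (cut N (fun y => 1 - ψ y) z) - cut N (fun y => 1 - ψ y) z) x = 0 := by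
  intro x hx
  simp only [Pi.sub_apply, transS, cut, hz x hx, mul_zero, sub_zero, ← sub_eq_add_neg]
  by_cases hy : Ω (x - unitVec N μ)
  · by_cases hzy : z (x - unitVec N μ) = 0
    · rw [hzy, mul_zero]
    · rw [hone _ hy (by rwa [sub_add_cancel]) hzy, sub_self, Complex.ofReal_zero, zero_mul]
  · rw [hz _ hy, mul_zero]

/-- **ONE CUT PIECE** under relative smoothness: `‖∂_μ∂_μ(φz)‖² ≤ 2‖c‖·√(2E(z) + 2d‖c‖²ℓ₁²‖z‖²)·(‖1_ΩΔz‖ + Σ_ν(2‖c‖ℓ₁‖∂_νz‖ + ‖c‖²ℓ₂‖z‖))`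
for any relatively smooth `φ` whose piece translates inside `Ω`. [folklore] -/
theorem nsq_sdiff_sdiff_cut_le_rel {Ω : Tor N → Prop} [DecidablePred Ω] (c : ℂ) (hc : c ≠ 0) (μ : Fin d) {v : Tor N}
    (hv : v = unitVec N μ ∨ v = -unitVec N μ) {φ : Tor N → ℝ} {ℓ₁ ℓ₂ : ℝ} {z : Tor N → ℂ} (hφ : RelSmooth N Ω z φ ℓ₁ ℓ₂)
    (hz : ∀ x, ¬ Ω x → z x = 0) (hadm : ∀ x, ¬ Ω x → (transS N v (cut N φ z) - cut N φ z) x = 0) :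
    nsq (sdiff N c μ *ᵥ (sdiff N c μ *ᵥ cut N φ z))
      ≤ 2 * ‖c‖ * Real.sqrt (2 * energy N c z + 2 * d * ‖c‖ ^ 2 * ℓ₁ ^ 2 * nsq z)
          * (Real.sqrt (nsqOn Ω (LapS N c *ᵥ z))
              + ∑ ν, (2 * ‖c‖ * ℓ₁ * Real.sqrt (nsq (sdiff N c ν *ᵥ z)) + ‖c‖ ^ 2 * ℓ₂ * Real.sqrt (nsq z))) := by
  have hmain := nsq_sdiff_sdiff_le_of_admissible N c hc μ hv (cut N φ z) (restrictTo Ω (LapS N c *ᵥ cut N φ z)) hadm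
    (fun x hx => by simp [restrictTo, hx])
  have hE : Real.sqrt (∑ ν, nsq (sdiff N c ν *ᵥ cut N φ z)) ≤ Real.sqrt (2 * energy N c z + 2 * d * ‖c‖ ^ 2 * ℓ₁ ^ 2 * nsq z) :=
    Real.sqrt_le_sqrt (energy_cut_le_rel N c hφ hz)
  have hR := sqrt_nsq_restrict_LapS_cut_le_rel N c hc hφ
  have hc0 : 0 ≤ 2 * ‖c‖ := by positivity
  calc nsq (sdiff N c μ *ᵥ (sdiff N c μ *ᵥ cut N φ z))
      ≤ 2 * ‖c‖ * Real.sqrt (∑ ν, nsq (sdiff N c ν *ᵥ cut N φ z)) * Real.sqrt (nsq (restrictTo Ω (LapS N c *ᵥ cut N φ z))) := hmain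
    _ ≤ 2 * ‖c‖ * Real.sqrt (2 * energy N c z + 2 * d * ‖c‖ ^ 2 * ℓ₁ ^ 2 * nsq z)
          * (Real.sqrt (nsqOn Ω (LapS N c *ᵥ z))
              + ∑ ν, (2 * ‖c‖ * ℓ₁ * Real.sqrt (nsq (sdiff N c ν *ᵥ z)) + ‖c‖ ^ 2 * ℓ₂ * Real.sqrt (nsq z))) :=
        mul_le_mul (mul_le_mul_of_nonneg_left hE hc0) hR (Real.sqrt_nonneg _) (mul_nonneg hc0 (Real.sqrt_nonneg _))

/-- **THE END UNDER RELATIVE HYPOTHESES**: for `z` supported in `Ω`, a cutoff `ψ` relatively smooth w.r.t. `z` and admissible along `μ`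
WHERE `z ≠ 0`, `‖∂_μ∂_μ z‖² ≤ 8‖c‖·√(2E(z) + 2d‖c‖²ℓ₁²‖z‖²)·(‖1_ΩΔz‖ + Σ_ν(2‖c‖ℓ₁‖∂_νz‖ + ‖c‖²ℓ₂‖z‖))` — gen 3's bound verbatim.
[folklore] -/
theorem nsq_sdiff_sdiff_le_rel {Ω : Tor N → Prop} [DecidablePred Ω] {μ : Fin d} {ψ : Tor N → ℝ} {ℓ₁ ℓ₂ : ℝ} {z : Tor N → ℂ}
    (hψ : RelSmooth N Ω z ψ ℓ₁ ℓ₂) (hzero : ∀ x, Ω x → ¬ Ω (x - unitVec N μ) → z x ≠ 0 → ψ x = 0)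
    (hone : ∀ x, Ω x → ¬ Ω (x + unitVec N μ) → z x ≠ 0 → ψ x = 1) (c : ℂ) (hc : c ≠ 0) (hz : ∀ x, ¬ Ω x → z x = 0) :
    nsq (sdiff N c μ *ᵥ (sdiff N c μ *ᵥ z))
      ≤ 8 * ‖c‖ * Real.sqrt (2 * energy N c z + 2 * d * ‖c‖ ^ 2 * ℓ₁ ^ 2 * nsq z)
          * (Real.sqrt (nsqOn Ω (LapS N c *ᵥ z))
              + ∑ ν, (2 * ‖c‖ * ℓ₁ * Real.sqrt (nsq (sdiff N c ν *ᵥ z)) + ‖c‖ ^ 2 * ℓ₂ * Real.sqrt (nsq z))) := by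
  have hP := nsq_sdiff_sdiff_cut_le_rel N (Ω := Ω) c hc μ (Or.inl rfl) hψ hz (admissible_pos_rel N hzero hz)
  have hM := nsq_sdiff_sdiff_cut_le_rel N (Ω := Ω) c hc μ (Or.inr rfl) hψ.compl hz (admissible_neg_rel N hone hz)
  have hsplit : sdiff N c μ *ᵥ (sdiff N c μ *ᵥ z)
      = sdiff N c μ *ᵥ (sdiff N c μ *ᵥ cut N ψ z) + sdiff N c μ *ᵥ (sdiff N c μ *ᵥ cut N (fun y => 1 - ψ y) z) := by
    rw [← Matrix.mulVec_add, ← Matrix.mulVec_add, cut_add_cut_compl]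
  rw [hsplit]
  refine (nsq_add_le _ _).trans ?_
  linarith

/-- **THE END, adjoint-sandwich form** `‖∂_μᴴ∂_μ z‖² ≤ …` (the (C-glob) input). [folklore] -/
theorem nsq_sdiffH_sdiff_le_rel {Ω : Tor N → Prop} [DecidablePred Ω] {μ : Fin d} {ψ : Tor N → ℝ} {ℓ₁ ℓ₂ : ℝ} {z : Tor N → ℂ}
    (hψ : RelSmooth N Ω z ψ ℓ₁ ℓ₂) (hzero : ∀ x, Ω x → ¬ Ω (x - unitVec N μ) → z x ≠ 0 → ψ x = 0)
    (hone : ∀ x, Ω x → ¬ Ω (x + unitVec N μ) → z x ≠ 0 → ψ x = 1) (c : ℂ) (hc : c ≠ 0) (hz : ∀ x, ¬ Ω x → z x = 0) :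
    nsq ((sdiff N c μ)ᴴ *ᵥ (sdiff N c μ *ᵥ z))
      ≤ 8 * ‖c‖ * Real.sqrt (2 * energy N c z + 2 * d * ‖c‖ ^ 2 * ℓ₁ ^ 2 * nsq z)
          * (Real.sqrt (nsqOn Ω (LapS N c *ᵥ z))
              + ∑ ν, (2 * ‖c‖ * ℓ₁ * Real.sqrt (nsq (sdiff N c ν *ᵥ z)) + ‖c‖ ^ 2 * ℓ₂ * Real.sqrt (nsq z))) := by
  rw [nsq_sdiffH_sdiff_eq N c hc]
  exact nsq_sdiff_sdiff_le_rel N hψ hzero hone c hc hz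

/-- CONSISTENCY (kernel): gen 3's END is the special case of a globally admissible cutoff. -/
example {Ω : Tor N → Prop} [DecidablePred Ω] {μ : Fin d} {ψ : Tor N → ℝ} {ℓ₁ ℓ₂ : ℝ} (hψ : AdmissibleCutoff N Ω μ ψ ℓ₁ ℓ₂)
    (c : ℂ) (hc : c ≠ 0) {z : Tor N → ℂ} (hz : ∀ x, ¬ Ω x → z x = 0) :
    nsq (sdiff N c μ *ᵥ (sdiff N c μ *ᵥ z))
      ≤ 8 * ‖c‖ * Real.sqrt (2 * energy N c z + 2 * d * ‖c‖ ^ 2 * ℓ₁ ^ 2 * nsq z)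
          * (Real.sqrt (nsqOn Ω (LapS N c *ᵥ z))
              + ∑ ν, (2 * ‖c‖ * ℓ₁ * Real.sqrt (nsq (sdiff N c ν *ᵥ z)) + ‖c‖ ^ 2 * ℓ₂ * Real.sqrt (nsq z))) :=
  nsq_sdiff_sdiff_le_rel N (RelSmooth.of_admissibleCutoff hψ z) (fun x hx hx' _ => hψ.zero_of x hx hx')
    (fun x hx hx' _ => hψ.one_of x hx hx') c hc hz

end Summit.QuantumFields.BalabanUV.T4Continuum.DirichletRelativeBesov

end
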